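import Mathlib
import HarnessLib
import Literature.MathematicalPhysics.QuantumFieldTheory.Luscher2010.EulerStepProofs
import Literature.MathematicalPhysics.QuantumFieldTheory.TiltedExponentMorseBounds
import Summits.Ventures.LatticeQCDFlow.Exactness.SUNResidualLayerContraction

/-!
# The engine's residual exponent with polynomial staple weights is `κ`-Lipschitz on `U(N)` with `κ = Σ_j Σ_k (1 + k)|a_{jk}|` — the number `contraction_bound` certifies; hence the layer is bijective whenever that number is `< 1`

HONEST FRAMING: exact (Metropolis-corrected) sampling algorithms for lattice gauge theory;
figures of merit are autocorrelation/cost numbers at stated couplings and volumes; no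
continuum-physics claim.

Venture `LatticeQCDFlow` (cell pub-lqcd), topic `Exactness`; FANOUT row 10 (`eng-equiv`, engine
`latflow.equiv`, module `equiv/residual.py`: "`Q_l(U) = Σ_j g_j(c_j) A_j`, `A_j = −TA(U C_j)`,
`c_j = Re tr(U C_j)/N`, … `g_j(c) = Σ_k a_{j,k} c^k`", and its guard
"`kappa(x) := Σ_j Σ_k (1 + k)|a_{j,k}(x)|` (each `C_j` is ONE staple = product of unitaries,
`‖C_j‖₂ = 1`, `|c_j| ≤ 1`), so `kappa < 1` is a SUFFICIENT condition for a unique preimage";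
"Pure stout (`Kp = 1`, equal rho on the `J = 2(D−1)` staples): `kappa = J|rho|`";
`contraction_bound`, `NonBijectiveLayer`; releases `equiv-0.1.0 … 0.4.1`; `flows_jax.layers.
stout_kappa`).  NEW WORK of the cell over `SUNResidualLayerContraction.lean` (the abstract
certificate: a `κ`-Lipschitz `𝔰𝔲(n)`-valued exponent with `κ < 1` gives a bijective layer) and the
tree's Frobenius tools (`Luscher2010/EulerStepProofs.lean`, `TiltedExponentMorseBounds.lean`);
nothing is cited as a fact; no number; no definition is introduced.  Printed counterparts, NAMED
ONLY: Lüscher, CMP 293 (2010) 899, App. D; Abbott et al., arXiv:2305.02402 §4.2.1; Morningstar–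
Peardon, PRD 69 (2004) 054501.

## What is typed (`n` arbitrary; `J` staples `C_j ∈ U(n)` indexed by a finite type; degree `< K`)

The exponent, written inline exactly as the engine computes it,
`Q(U) = Σ_j (Σ_{k<K} a_{jk} (Re tr(U C_j)/n)^k) • (−P(U C_j))` (`P = suProj`, the traceless
anti-Hermitian part `TA`):

* scalar tools: `abs_pow_sub_pow_le` (`|c^k − c'^k| ≤ k|c − c'|` on `[−1, 1]`),
  `abs_polyWeight_le` (`|g(c)| ≤ Σ_k |a_k|`), `abs_polyWeight_sub_le`
  (`|g(c) − g(c')| ≤ (Σ_k k|a_k|)|c − c'|`); `abs_loopTrace_le_one` (`|Re tr W / n| ≤ 1` for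
  unitary `W`); `abs_loopTrace_sub_mul_le` (`|c(U) − c(V)| · ‖P(V C)‖_F ≤ ‖U − V‖_F`: the `√n` of
  `|Re tr X| ≤ √n ‖X‖_F` cancels the `√n = ‖V C‖_F`);
* `residualExponent_skew` — `Q(U)` is skew-Hermitian and traceless (any `U`);
* **`frobNorm_residualExponent_sub_le`** — THE CERTIFICATE'S CONTENT:
  `‖Q(U) − Q(V)‖_F ≤ (Σ_j Σ_{k<K} (1 + k)|a_{jk}|) · ‖U − V‖_F` for all `U, V ∈ U(n)`;
* **`existsUnique_engineResidual_preimage`**, **`engineResidualLayer_bijective`**,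
  `frobNorm_engineResidual_inverseIteration_le` — with `Σ_j Σ_k (1 + k)|a_{jk}| < 1` the engine's
  layer `U ↦ e^{Q(U)} U` has exactly one pre-image in `SU(n)` for every target, is a bijection of
  `SU(n)`, and its `inverse` iteration converges at the certified geometric rate — for EVERY `n`
  (the tree had the unit-weight Wilson-flow Euler step, `Luscher2010.eulerStep_bijective`, and
  row 14's `SU(2)` rung);
* **`frobNorm_stoutExponent_sub_le`**, **`stoutLayer_bijective`** — pure stout with one real
  weight `ρ` on a sum `S = Σ_j C_j` of `J` unitary staples: `κ = J|ρ|`, bijective for `J|ρ| < 1`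
  (`|ρ| < 1/2, 1/4, 1/6` at `D = 2, 3, 4`).

NOT here: coefficients depending on frozen context (they enter `Q` as constants per active link,
which is this file applied linkwise); the Jacobian; any number.
-/

noncomputable section

namespace Summit.Ventures.LatticeQCDFlow.Exactness

open Literature.MathematicalPhysics.QuantumFieldTheory
open Literature.MathematicalPhysics.QuantumFieldTheory.Luscher2010
open Literature.MathematicalPhysics.QuantumFieldTheory.OneLinkLaplace
  (abs_re_trace_le frobNorm_of_mem_unitaryGroup)
open scoped Matrix

variable {n : ℕ}

/-! ## Scalar tools: polynomial weights on `[−1, 1]` -/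

/-- `|c^k − c'^k| ≤ k |c − c'|` for `|c|, |c'| ≤ 1`. -/
theorem abs_pow_sub_pow_le {c c' : ℝ} (hc : |c| ≤ 1) (hc' : |c'| ≤ 1) (k : ℕ) :
    |c ^ k - c' ^ k| ≤ k * |c - c'| := by
  induction k with
  | zero => simp
  | succ k ih =>
    have hsplit : c ^ (k + 1) - c' ^ (k + 1) = c ^ k * (c - c') + (c ^ k - c' ^ k) * c' := by ring
    rw [hsplit]
    have hck : |c ^ k| ≤ 1 := by rw [abs_pow]; exact pow_le_one₀ (abs_nonneg c) hc
    calc |c ^ k * (c - c') + (c ^ k - c' ^ k) * c'|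
          ≤ |c ^ k * (c - c')| + |(c ^ k - c' ^ k) * c'| := abs_add_le _ _
      _ = |c ^ k| * |c - c'| + |c ^ k - c' ^ k| * |c'| := by rw [abs_mul, abs_mul]
      _ ≤ 1 * |c - c'| + k * |c - c'| * 1 :=
          add_le_add (mul_le_mul_of_nonneg_right hck (abs_nonneg _))
            (mul_le_mul ih hc' (abs_nonneg _) (by positivity))
      _ = (k + 1 : ℕ) * |c - c'| := by push_cast; ring

/-- `|Σ_{k<K} a_k c^k| ≤ Σ_{k<K} |a_k|` for `|c| ≤ 1`. -/
theorem abs_polyWeight_le (a : ℕ → ℝ) (K : ℕ) {c : ℝ} (hc : |c| ≤ 1) :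
    |∑ k ∈ Finset.range K, a k * c ^ k| ≤ ∑ k ∈ Finset.range K, |a k| := by
  refine (Finset.abs_sum_le_sum_abs _ _).trans (Finset.sum_le_sum fun k _ => ?_)
  rw [abs_mul, abs_pow]
  calc |a k| * |c| ^ k ≤ |a k| * 1 :=
        mul_le_mul_of_nonneg_left (pow_le_one₀ (abs_nonneg c) hc) (abs_nonneg _)
    _ = |a k| := mul_one _

/-- `|g(c) − g(c')| ≤ (Σ_{k<K} k|a_k|) |c − c'|` for `g(c) = Σ_{k<K} a_k c^k` and `|c|, |c'| ≤ 1`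
(the `k|a_k|` half of the engine's `(1 + k)|a_k|`). -/
theorem abs_polyWeight_sub_le (a : ℕ → ℝ) (K : ℕ) {c c' : ℝ} (hc : |c| ≤ 1) (hc' : |c'| ≤ 1) :
    |∑ k ∈ Finset.range K, a k * c ^ k - ∑ k ∈ Finset.range K, a k * c' ^ k| ≤
      (∑ k ∈ Finset.range K, k * |a k|) * |c - c'| := by
  rw [← Finset.sum_sub_distrib, Finset.sum_mul]
  refine (Finset.abs_sum_le_sum_abs _ _).trans (Finset.sum_le_sum fun k _ => ?_)
  rw [← mul_sub, abs_mul]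
  calc |a k| * |c ^ k - c' ^ k| ≤ |a k| * (k * |c - c'|) :=
        mul_le_mul_of_nonneg_left (abs_pow_sub_pow_le hc hc' k) (abs_nonneg _)
    _ = k * |a k| * |c - c'| := by ring

/-! ## The normalised loop trace `c = Re tr(U C)/n` -/

/-- **`|Re tr W / n| ≤ 1` for unitary `W`** (`|Re tr W| ≤ √n ‖W‖_F = n`): the engine's
"`|c_j| ≤ 1`". -/
theorem abs_loopTrace_le_one {W : Matrix (Fin n) (Fin n) ℂ} (hW : W ∈ Matrix.unitaryGroup (Fin n) ℂ) :
    |W.trace.re / n| ≤ 1 := by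
  rcases Nat.eq_zero_or_pos n with hn | hn
  · subst hn
    simp
  · have hn' : (0 : ℝ) < n := by exact_mod_cast hn
    rw [abs_div, Nat.abs_cast, div_le_one hn']
    calc |W.trace.re| ≤ Real.sqrt n * frobNorm W := abs_re_trace_le W
      _ = Real.sqrt n * Real.sqrt n := by rw [frobNorm_of_mem_unitaryGroup hW]
      _ = n := Real.mul_self_sqrt hn'.le

/-- **The trace variation times the size of `P(V C)` is controlled by `‖U − V‖_F`**:
`|Re tr(U C)/n − Re tr(V C)/n| · ‖P(V C)‖_F ≤ ‖U − V‖_F` for unitary `C, V` — the `√n` from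
`|Re tr X| ≤ √n ‖X‖_F` cancels against `‖P(V C)‖_F ≤ ‖V C‖_F = √n`. -/
theorem abs_loopTrace_sub_mul_le {U V C : Matrix (Fin n) (Fin n) ℂ}
    (hV : V ∈ Matrix.unitaryGroup (Fin n) ℂ) (hC : C ∈ Matrix.unitaryGroup (Fin n) ℂ) :
    |(U * C).trace.re / n - (V * C).trace.re / n| * frobNorm (suProj (V * C)) ≤ frobNorm (U - V) := by
  have hVC : V * C ∈ Matrix.unitaryGroup (Fin n) ℂ := mul_mem hV hC
  have hP : frobNorm (suProj (V * C)) ≤ Real.sqrt n :=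
    (frobNorm_suProj_le _).trans (le_of_eq (frobNorm_of_mem_unitaryGroup hVC))
  rcases Nat.eq_zero_or_pos n with hn | hn
  · subst hn
    have h0 : frobNorm (suProj (V * C)) ≤ 0 := by simpa using hP
    have h0' : frobNorm (suProj (V * C)) = 0 := le_antisymm h0 (frobNorm_nonneg _)
    rw [h0', mul_zero]
    exact frobNorm_nonneg _
  · have hn' : (0 : ℝ) < n := by exact_mod_cast hn
    have htr : |(U * C).trace.re / n - (V * C).trace.re / n| ≤ Real.sqrt n * frobNorm (U - V) / n := by
      rw [← sub_div, abs_div, Nat.abs_cast, ← Complex.sub_re, ← Matrix.trace_sub, ← Matrix.sub_mul]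
      refine div_le_div_of_nonneg_right ?_ hn'.le
      calc |((U - V) * C).trace.re| ≤ Real.sqrt n * frobNorm ((U - V) * C) := abs_re_trace_le _
        _ = Real.sqrt n * frobNorm (U - V) := by rw [frobNorm_mul_unitary _ hC]
    calc |(U * C).trace.re / n - (V * C).trace.re / n| * frobNorm (suProj (V * C))
          ≤ Real.sqrt n * frobNorm (U - V) / n * Real.sqrt n :=
            mul_le_mul htr hP (frobNorm_nonneg _)
              (div_nonneg (mul_nonneg (Real.sqrt_nonneg _) (frobNorm_nonneg _)) hn'.le)
      _ = frobNorm (U - V) * (Real.sqrt n * Real.sqrt n / n) := by ring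
      _ = frobNorm (U - V) := by rw [Real.mul_self_sqrt hn'.le, div_self hn'.ne', mul_one]

/-! ## The engine's exponent: values in `𝔰𝔲(n)` and the Lipschitz certificate -/

/-- **`Q(U) ∈ 𝔰𝔲(n)`**: the engine's exponent
`Q(U) = Σ_j (Σ_{k<K} a_{jk} (Re tr(U C_j)/n)^k) • (−P(U C_j))` is skew-Hermitian and traceless,
for every `U` (real weights, `P` has values in `𝔰𝔲(n)`). -/
theorem residualExponent_skew {ι : Type*} [Fintype ι] (a : ι → ℕ → ℝ) (K : ℕ)
    (C : ι → Matrix (Fin n) (Fin n) ℂ) (U : Matrix (Fin n) (Fin n) ℂ) :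
    (∑ j, ((∑ k ∈ Finset.range K, a j k * ((U * C j).trace.re / n) ^ k : ℝ) : ℂ) •
        (-suProj (U * C j)))ᴴ =
      -∑ j, ((∑ k ∈ Finset.range K, a j k * ((U * C j).trace.re / n) ^ k : ℝ) : ℂ) •
        (-suProj (U * C j)) ∧
    (∑ j, ((∑ k ∈ Finset.range K, a j k * ((U * C j).trace.re / n) ^ k : ℝ) : ℂ) •
        (-suProj (U * C j))).trace = 0 := by
  refine ⟨?_, ?_⟩
  · rw [Matrix.conjTranspose_sum, ← Finset.sum_neg_distrib]
    refine Finset.sum_congr rfl fun j _ => ?_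
    rw [Matrix.conjTranspose_smul, Matrix.conjTranspose_neg, conjTranspose_suProj, neg_neg,
      Complex.star_def, Complex.conj_ofReal, smul_neg, neg_neg]
  · rw [Matrix.trace_sum]
    refine Finset.sum_eq_zero fun j _ => ?_
    rw [Matrix.trace_smul, Matrix.trace_neg, trace_suProj, neg_zero, smul_zero]

/-- **THE CERTIFICATE'S CONTENT.**  For unitary staples `C_j` and any real coefficients, the
engine's exponent is Lipschitz on `U(n)` in the Frobenius norm with constant
`κ = Σ_j Σ_{k<K} (1 + k)|a_{jk}|`:
`‖Q(U) − Q(V)‖_F ≤ κ ‖U − V‖_F` for all `U, V ∈ U(n)`.  Per staple: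
`g(c)•A − g(c')•A' = g(c)•(A − A') + (g(c) − g(c'))•A'` with `|g(c)| ≤ Σ|a_k|`,
`‖A − A'‖_F = ‖P((U − V)C)‖_F ≤ ‖U − V‖_F`, and `|g(c) − g(c')| ‖A'‖_F ≤ (Σ k|a_k|) ‖U − V‖_F`. -/
theorem frobNorm_residualExponent_sub_le {ι : Type*} [Fintype ι] (a : ι → ℕ → ℝ) (K : ℕ)
    {C : ι → Matrix (Fin n) (Fin n) ℂ} (hC : ∀ j, C j ∈ Matrix.unitaryGroup (Fin n) ℂ)
    {U V : Matrix (Fin n) (Fin n) ℂ} (hU : U ∈ Matrix.unitaryGroup (Fin n) ℂ)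
    (hV : V ∈ Matrix.unitaryGroup (Fin n) ℂ) :
    frobNorm (∑ j, ((∑ k ∈ Finset.range K, a j k * ((U * C j).trace.re / n) ^ k : ℝ) : ℂ) •
          (-suProj (U * C j)) -
        ∑ j, ((∑ k ∈ Finset.range K, a j k * ((V * C j).trace.re / n) ^ k : ℝ) : ℂ) •
          (-suProj (V * C j))) ≤
      (∑ j, ∑ k ∈ Finset.range K, (1 + k) * |a j k|) * frobNorm (U - V) := by
  rw [← Finset.sum_sub_distrib, Finset.sum_mul]
  refine (frobNorm_sum_le _ _).trans (Finset.sum_le_sum fun j _ => ?_)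
  -- one staple
  set c := (U * C j).trace.re / n with hc
  set c' := (V * C j).trace.re / n with hc'
  set g := ∑ k ∈ Finset.range K, a j k * c ^ k with hg
  set g' := ∑ k ∈ Finset.range K, a j k * c' ^ k with hg'
  have hcle : |c| ≤ 1 := abs_loopTrace_le_one (mul_mem hU (hC j))
  have hc'le : |c'| ≤ 1 := abs_loopTrace_le_one (mul_mem hV (hC j))
  have hsplit : ((g : ℝ) : ℂ) • (-suProj (U * C j)) - ((g' : ℝ) : ℂ) • (-suProj (V * C j)) =
      ((g : ℝ) : ℂ) • (-(suProj (U * C j) - suProj (V * C j))) +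
        (((g : ℝ) : ℂ) - ((g' : ℝ) : ℂ)) • (-suProj (V * C j)) := by
    rw [sub_smul, smul_neg, smul_neg, smul_neg, smul_neg, smul_sub]
    abel
  rw [hsplit]
  have h1 : frobNorm (((g : ℝ) : ℂ) • (-(suProj (U * C j) - suProj (V * C j)))) ≤
      (∑ k ∈ Finset.range K, |a j k|) * frobNorm (U - V) := by
    rw [frobNorm_smul, Complex.norm_real, Real.norm_eq_abs, ← suProj_sub, ← Matrix.sub_mul]
    refine mul_le_mul (abs_polyWeight_le (a j) K hcle) ?_ (frobNorm_nonneg _)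
      (Finset.sum_nonneg fun k _ => abs_nonneg _)
    calc frobNorm (-suProj ((U - V) * C j)) = frobNorm (suProj ((U - V) * C j)) := by
          rw [← neg_one_smul ℂ, frobNorm_smul, norm_neg, norm_one, one_mul]
      _ ≤ frobNorm ((U - V) * C j) := frobNorm_suProj_le _
      _ = frobNorm (U - V) := frobNorm_mul_unitary _ (hC j)
  have h2 : frobNorm ((((g : ℝ) : ℂ) - ((g' : ℝ) : ℂ)) • (-suProj (V * C j))) ≤
      (∑ k ∈ Finset.range K, k * |a j k|) * frobNorm (U - V) := by
    rw [← Complex.ofReal_sub, frobNorm_smul, Complex.norm_real, Real.norm_eq_abs,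
      ← neg_one_smul ℂ (suProj (V * C j)), frobNorm_smul, norm_neg, norm_one, one_mul]
    calc |g - g'| * frobNorm (suProj (V * C j))
          ≤ (∑ k ∈ Finset.range K, k * |a j k|) * |c - c'| * frobNorm (suProj (V * C j)) :=
            mul_le_mul_of_nonneg_right (abs_polyWeight_sub_le (a j) K hcle hc'le) (frobNorm_nonneg _)
      _ = (∑ k ∈ Finset.range K, k * |a j k|) * (|c - c'| * frobNorm (suProj (V * C j))) := by ring
      _ ≤ (∑ k ∈ Finset.range K, k * |a j k|) * frobNorm (U - V) :=
            mul_le_mul_of_nonneg_left (abs_loopTrace_sub_mul_le hV (hC j))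
              (Finset.sum_nonneg fun k _ => by positivity)
  calc frobNorm (((g : ℝ) : ℂ) • (-(suProj (U * C j) - suProj (V * C j))) +
          (((g : ℝ) : ℂ) - ((g' : ℝ) : ℂ)) • (-suProj (V * C j)))
        ≤ (∑ k ∈ Finset.range K, |a j k|) * frobNorm (U - V) +
          (∑ k ∈ Finset.range K, k * |a j k|) * frobNorm (U - V) := (frobNorm_add_le _ _).trans (add_le_add h1 h2)
    _ = (∑ k ∈ Finset.range K, (1 + k) * |a j k|) * frobNorm (U - V) := by
          rw [← add_mul, ← Finset.sum_add_distrib]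
          congr 1
          refine Finset.sum_congr rfl fun k _ => ?_
          ring

/-! ## The engine's layer on `SU(n)`: unique pre-image, bijection, inverse iteration — every `n` -/

/-- The certified number is nonnegative: `0 ≤ Σ_j Σ_{k<K} (1 + k)|a_{jk}|`. -/
theorem contractionBound_nonneg {ι : Type*} [Fintype ι] (a : ι → ℕ → ℝ) (K : ℕ) :
    0 ≤ ∑ j, ∑ k ∈ Finset.range K, (1 + (k : ℝ)) * |a j k| :=
  Finset.sum_nonneg fun _ _ => Finset.sum_nonneg fun _ _ => by positivity

/-- **The engine's guard, typed: `Σ_j Σ_k (1 + k)|a_{jk}| < 1` ⟹ exactly one pre-image.**  For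
unitary staples `C_j` and real coefficients with `Σ_j Σ_{k<K} (1 + k)|a_{jk}| < 1`, every
`U' ∈ SU(n)` has exactly one `U ∈ SU(n)` with `e^{Q(U)} U = U'`, `Q` the engine's exponent —
for every `n` (`existsUnique_residual_preimage` fed with `frobNorm_residualExponent_sub_le`). -/
theorem existsUnique_engineResidual_preimage {ι : Type*} [Fintype ι] (a : ι → ℕ → ℝ) (K : ℕ)
    {C : ι → Matrix (Fin n) (Fin n) ℂ} (hC : ∀ j, C j ∈ Matrix.unitaryGroup (Fin n) ℂ)
    (hκ : ∑ j, ∑ k ∈ Finset.range K, (1 + (k : ℝ)) * |a j k| < 1)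
    {U' : Matrix (Fin n) (Fin n) ℂ} (hU' : U' ∈ Matrix.specialUnitaryGroup (Fin n) ℂ) :
    ∃ U ∈ Matrix.specialUnitaryGroup (Fin n) ℂ,
      NormedSpace.exp (∑ j, ((∑ k ∈ Finset.range K, a j k * ((U * C j).trace.re / n) ^ k : ℝ) : ℂ) •
          (-suProj (U * C j))) * U = U' ∧
      ∀ V ∈ Matrix.specialUnitaryGroup (Fin n) ℂ,
        NormedSpace.exp (∑ j, ((∑ k ∈ Finset.range K, a j k * ((V * C j).trace.re / n) ^ k : ℝ) : ℂ) •
          (-suProj (V * C j))) * V = U' → V = U :=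
  existsUnique_residual_preimage
    (contractionBound_nonneg a K) hκ (fun U _ => residualExponent_skew a K C U)
    (fun _ hU _ hV => frobNorm_residualExponent_sub_le a K hC
      (Matrix.mem_specialUnitaryGroup_iff.mp hU).1 (Matrix.mem_specialUnitaryGroup_iff.mp hV).1) hU'

/-- **The engine's residual layer is a bijection of `SU(n)`, every `n`**, under its own
certificate `Σ_j Σ_k (1 + k)|a_{jk}| < 1`. -/
theorem engineResidualLayer_bijective {ι : Type*} [Fintype ι] (a : ι → ℕ → ℝ) (K : ℕ)
    {C : ι → Matrix (Fin n) (Fin n) ℂ} (hC : ∀ j, C j ∈ Matrix.unitaryGroup (Fin n) ℂ)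
    (hκ : ∑ j, ∑ k ∈ Finset.range K, (1 + (k : ℝ)) * |a j k| < 1) :
    Function.Bijective fun U : Matrix.specialUnitaryGroup (Fin n) ℂ =>
      (⟨NormedSpace.exp (∑ j, ((∑ k ∈ Finset.range K,
            a j k * (((U : Matrix (Fin n) (Fin n) ℂ) * C j).trace.re / n) ^ k : ℝ) : ℂ) •
          (-suProj ((U : Matrix (Fin n) (Fin n) ℂ) * C j))) * U,
        residual_value_mem (fun U _ => residualExponent_skew a K C U) U.2⟩ :
        Matrix.specialUnitaryGroup (Fin n) ℂ) :=
  residualLayer_bijective (contractionBound_nonneg a K) hκ (fun U _ => residualExponent_skew a K C U)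
    fun _ hU _ hV => frobNorm_residualExponent_sub_le a K hC
      (Matrix.mem_specialUnitaryGroup_iff.mp hU).1 (Matrix.mem_specialUnitaryGroup_iff.mp hV).1

/-- **The engine's `inverse` converges at the certified rate**: with `κ = Σ_j Σ_k (1 + k)|a_{jk}|`
(no smallness needed for the estimate itself), from any start `U₀ ∈ SU(n)` the iterates
`U_{k+1} = e^{−Q(U_k)} U'` stay in `SU(n)` and `‖U_k − U⋆‖_F ≤ κ^k ‖U₀ − U⋆‖_F` for the pre-image
`U⋆` of `U'`. -/
theorem frobNorm_engineResidual_inverseIteration_le {ι : Type*} [Fintype ι] (a : ι → ℕ → ℝ)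
    (K : ℕ) {C : ι → Matrix (Fin n) (Fin n) ℂ} (hC : ∀ j, C j ∈ Matrix.unitaryGroup (Fin n) ℂ)
    {U' Us U₀ : Matrix (Fin n) (Fin n) ℂ} (hU' : U' ∈ Matrix.specialUnitaryGroup (Fin n) ℂ)
    (hUs : Us ∈ Matrix.specialUnitaryGroup (Fin n) ℂ)
    (hfix : NormedSpace.exp (∑ j, ((∑ k ∈ Finset.range K, a j k * ((Us * C j).trace.re / n) ^ k : ℝ) : ℂ) •
        (-suProj (Us * C j))) * Us = U')
    (hU₀ : U₀ ∈ Matrix.specialUnitaryGroup (Fin n) ℂ) (m : ℕ) :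
    (fun U => NormedSpace.exp (-∑ j, ((∑ k ∈ Finset.range K,
          a j k * ((U * C j).trace.re / n) ^ k : ℝ) : ℂ) • (-suProj (U * C j))) * U')^[m] U₀ ∈
        Matrix.specialUnitaryGroup (Fin n) ℂ ∧
      frobNorm ((fun U => NormedSpace.exp (-∑ j, ((∑ k ∈ Finset.range K,
          a j k * ((U * C j).trace.re / n) ^ k : ℝ) : ℂ) • (-suProj (U * C j))) * U')^[m] U₀ - Us) ≤
        (∑ j, ∑ k ∈ Finset.range K, (1 + (k : ℝ)) * |a j k|) ^ m * frobNorm (U₀ - Us) :=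
  frobNorm_inverseIteration_le
    (contractionBound_nonneg a K) (fun U _ => residualExponent_skew a K C U)
    (fun _ hU _ hV => frobNorm_residualExponent_sub_le a K hC
      (Matrix.mem_specialUnitaryGroup_iff.mp hU).1 (Matrix.mem_specialUnitaryGroup_iff.mp hV).1)
    hU' hUs hfix hU₀ m

/-! ## Pure stout: one real weight `ρ` on a sum of `J` unitary staples, `κ = J|ρ|` -/

/-- **The stout exponent `−ρ P(U S)`, `S = Σ_j C_j`, is `J|ρ|`-Lipschitz** in the Frobenius norm
(`J = |ι|` unitary staples; any `U, V`):
`‖ρ P(U S) − ρ P(V S)‖_F = |ρ| ‖P((U − V) S)‖_F ≤ |ρ| Σ_j ‖(U − V) C_j‖_F = J|ρ| ‖U − V‖_F`. -/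
theorem frobNorm_stoutExponent_sub_le {ι : Type*} [Fintype ι] (ρ : ℝ)
    {C : ι → Matrix (Fin n) (Fin n) ℂ} (hC : ∀ j, C j ∈ Matrix.unitaryGroup (Fin n) ℂ)
    (U V : Matrix (Fin n) (Fin n) ℂ) :
    frobNorm (-((ρ : ℂ) • suProj (U * ∑ j, C j)) - -((ρ : ℂ) • suProj (V * ∑ j, C j))) ≤
      (Fintype.card ι * |ρ|) * frobNorm (U - V) := by
  rw [neg_sub_neg, ← smul_sub, ← suProj_sub, ← Matrix.sub_mul, frobNorm_smul, Complex.norm_real,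
    Real.norm_eq_abs, frobNorm_sub_comm U V]
  calc |ρ| * frobNorm (suProj ((V - U) * ∑ j, C j)) ≤ |ρ| * frobNorm ((V - U) * ∑ j, C j) :=
        mul_le_mul_of_nonneg_left (frobNorm_suProj_le _) (abs_nonneg ρ)
    _ = |ρ| * frobNorm (∑ j, (V - U) * C j) := by rw [Finset.mul_sum]
    _ ≤ |ρ| * ∑ j, frobNorm ((V - U) * C j) :=
        mul_le_mul_of_nonneg_left (frobNorm_sum_le _ _) (abs_nonneg ρ)
    _ = |ρ| * ∑ _j : ι, frobNorm (V - U) := by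
        congr 1
        exact Finset.sum_congr rfl fun j _ => frobNorm_mul_unitary _ (hC j)
    _ = Fintype.card ι * |ρ| * frobNorm (V - U) := by
        rw [Finset.sum_const, Finset.card_univ, nsmul_eq_mul]
        ring

/-- The stout exponent is skew-Hermitian and traceless. -/
theorem stoutExponent_skew (ρ : ℝ) (W : Matrix (Fin n) (Fin n) ℂ) :
    (-((ρ : ℂ) • suProj W))ᴴ = - -((ρ : ℂ) • suProj W) ∧ (-((ρ : ℂ) • suProj W)).trace = 0 := by
  refine ⟨?_, ?_⟩
  · rw [Matrix.conjTranspose_neg, Matrix.conjTranspose_smul, conjTranspose_suProj, Complex.star_def,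
      Complex.conj_ofReal, smul_neg]
  · rw [Matrix.trace_neg, Matrix.trace_smul, trace_suProj, smul_zero, neg_zero]

/-- **The pure stout layer `U ↦ e^{−ρ P(U S)} U` is a bijection of `SU(n)` whenever `J|ρ| < 1`**
(`S` the sum of `J` unitary staples; the engine's "`|rho| < 1/2` (`D = 2`), `1/4` (`D = 3`),
`1/6` (`D = 4`)" with `J = 2(D − 1)` plaquette staples; the tree's
`Luscher2010.eulerStep_bijective` is the unit-weight Wilson-flow instance of the same bound, one
link of a lattice configuration at a time). -/
theorem stoutLayer_bijective {ι : Type*} [Fintype ι] (ρ : ℝ)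
    {C : ι → Matrix (Fin n) (Fin n) ℂ} (hC : ∀ j, C j ∈ Matrix.unitaryGroup (Fin n) ℂ)
    (hρ : Fintype.card ι * |ρ| < 1) :
    Function.Bijective fun U : Matrix.specialUnitaryGroup (Fin n) ℂ =>
      (⟨NormedSpace.exp (-((ρ : ℂ) • suProj ((U : Matrix (Fin n) (Fin n) ℂ) * ∑ j, C j))) * U,
        residual_value_mem (fun U _ => stoutExponent_skew ρ (U * ∑ j, C j)) U.2⟩ :
        Matrix.specialUnitaryGroup (Fin n) ℂ) :=
  residualLayer_bijective (by positivity) hρ (fun U _ => stoutExponent_skew ρ (U * ∑ j, C j))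
    fun U _ V _ => frobNorm_stoutExponent_sub_le ρ hC U V

end Summit.Ventures.LatticeQCDFlow.Exactness
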